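import Summits.KontsevichZagierPeriods.KontsevichZagierPeriods.Theorems.VietaFibreKernelFormCut
import Summits.KontsevichZagierPeriods.KontsevichZagierPeriods.Theorems.VietaFibreKernelFormAveraging
import Literature.NumberTheory.Transcendental.SemialgebraicLineDeriv
import HarnessLib

/-!
# Crux `KernelForm` (stmt-KontsevichZagierPeriods-10447), line `Sketch`: the bump-body normal form

A sharpening of the kernel normal form `c ≡ [A] − [U]` of `VietaFibreKernelFormBodyDictionary`
(`exists_unitBody_sub_mem_relations`; this file does not import it):
the compact unit-volume body `A` may be taken ARBITRARILY CLOSE TO THE UNIT CUBE — sandwiched between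
the slabs `[0,1]^m × [0, 1 − ε]` and `[0,1]^m × [0, 1 + ε]` for any prescribed `0 < ε < 1`. It is the
closure of the region under the graph of `1 + w` over the cube, `w` the uniformly small cube
integrand of the averaging normal form (`exists_cubeRep_abs_integrand_le`, `|w| ≤ ε`, `∫ w = 0`),
reached by one integrand-additivity move and one Newton–Leibniz move (`KZ.exists_underGraph`).

* `exists_bumpBody_sub_mem_relations` — the normal form;
* `kernelForm_iff_bumpBody` — for every fixed `0 < ε < 1`: Conjecture 1 (kernel form) `⟺` every
  compact unit-volume body `ε`-sandwiched around the unit cube is KZ-equivalent to the cube. So a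
  counterexample to Conjecture 1, if any, is already an arbitrarily gentle semialgebraic bump on the
  cube, and no move-invariant of bodies that is continuous for the volume of the symmetric
  difference with the cube can detect it (body form of `moveInvariant_eq_zero_of_supContinuous`).

References: M. Kontsevich, D. Zagier, *Periods* (2001), §1.2, Problem 1; J. Cresson, J. Viu-Sos,
JTNB 34 (2022), §1; J. Viu-Sos, IJNT 17 (2021), Cor. 2.3, §4.2.
-/

noncomputable section

open MeasureTheory Set
open Literature.NumberTheory.Transcendental

namespace Summit.KontsevichZagierPeriods.KernelForm.LocaliseAtValuePrime

/-- Two unit-cube representations of any two dimensions are move-equivalent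
(`[U₀] * [U₁] ≡ [U₀]`, `[U₁] * [U₀] ≡ [U₁]` by `stub_cubeMul`, and commutativity modulo the moves).
[folklore] -/
theorem of_cube_sub_of_cube_mem_relations {m₀ m₁ : ℕ} (U₀ : KZ.IntegralRep m₀) (U₁ : KZ.IntegralRep m₁)
    (h₀d : U₀.domain = KZ.cube m₀) (h₀i : U₀.integrand = fun _ => 1)
    (h₁d : U₁.domain = KZ.cube m₁) (h₁i : U₁.integrand = fun _ => 1) :
    KZ.of U₁ - KZ.of U₀ ∈ KZ.relations := by
  have e₁ := stub_cubeMul m₁ U₁ (KZ.of U₀) h₁d h₁i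
  have e₂ := stub_cubeMul m₀ U₀ (KZ.of U₁) h₀d h₀i
  have e₃ := KZ.mul_sub_mul_comm_mem_relations (KZ.of U₀) (KZ.of U₁)
  have : KZ.of U₁ - KZ.of U₀ = (KZ.of U₀ * KZ.of U₁ - KZ.of U₀) -
      (KZ.of U₀ * KZ.of U₁ - KZ.of U₁ * KZ.of U₀) - (KZ.of U₁ * KZ.of U₀ - KZ.of U₁) := by abel
  rw [this]
  exact KZ.relations.sub_mem (KZ.relations.sub_mem e₁ e₃) e₂

/-- **Bump-body normal form.** For every `0 < ε < 1`, every formal `ℤ`-combination `c` of integral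
representations with `eval c = 0` is, modulo the moves, `[A] − [U]` with `U` the unit cube of some
dimension `m + 1` and `A` a compact `ℚ`-semialgebraic body of volume `1` (integrand `1`, non-empty
interior) sandwiched between the slabs of heights `1 − ε` and `1 + ε` over the cube `[0,1]^m`.
Proof: `c ≡ [[0,1]^m, w]` with `|w| ≤ ε` (averaging normal form), `[[0,1]^m, 1 + w] ≡ [w] + [U_m]`
(integrand additivity), the region under the graph of `1 + w ≥ 0` is one Newton–Leibniz move away
(`KZ.exists_underGraph`), and its closure is the body `A` (`KZ.exists_closure_of_integrand_one`).
[cite: ViuSos2021, Cor. 2.3] [folklore] -/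
theorem exists_bumpBody_sub_mem_relations :
    ∀ (c : KZ.FormalRep), KZ.eval c = 0 → ∀ {ε : ℝ}, 0 < ε → ε < 1 →
    ∃ (m : ℕ) (A U : KZ.IntegralRep (m + 1)), IsCompact A.domain ∧ (interior A.domain).Nonempty ∧
      (∀ x ∈ A.domain, A.integrand x = 1) ∧ A.value = 1 ∧ U.domain = KZ.cube (m + 1) ∧
      (U.integrand = fun _ => 1) ∧
      {z | (Fin.init z : Fin m → ℝ) ∈ KZ.cube m ∧ 0 ≤ z (Fin.last m) ∧ z (Fin.last m) ≤ 1 - ε} ⊆ A.domain ∧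
      A.domain ⊆ {z | (Fin.init z : Fin m → ℝ) ∈ KZ.cube m ∧ 0 ≤ z (Fin.last m) ∧ z (Fin.last m) ≤ 1 + ε} ∧
      c - (KZ.of A - KZ.of U) ∈ KZ.relations := by
  intro c hc ε hε hε1
  -- (1) averaging normal form `c ≡ [W]`, `W = [[0,1]^m, w]`, `|w| ≤ ε`
  obtain ⟨m, hm⟩ := exists_cubeRep_abs_integrand_le c hc
  obtain ⟨W, hWd, hWb, r₁⟩ := hm ε hε
  have hWv : W.value = 0 := by
    have h := eval_eq_zero_of_mem r₁
    simp only [map_sub, KZ.eval_of, hc] at h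
    linarith
  -- (2) the unit cubes `U₀` (dimension `m`) and `U` (dimension `m + 1`)
  obtain ⟨U₀, hU₀d, hU₀i⟩ := KZ.exists_oneRep (KZ.isSemialgebraic_cube (n := m))
    (by simp [KZ.volume_cube])
  obtain ⟨U, hUd, hUi⟩ := KZ.exists_oneRep (KZ.isSemialgebraic_cube (n := m + 1))
    (by simp [KZ.volume_cube])
  have hU₀v : U₀.value = 1 := by
    rw [KZ.IntegralRep.value_eq_volume_real U₀ (fun x _ => by rw [hU₀i]), hU₀d, KZ.volume_real_cube]
  -- (3) `H = [[0,1]^m, w + 1]`, and `[H] − [W] − [U₀] ∈ integrandAddRel`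
  have hcube : Literature.ModelTheory.ExponentialFields.IsSemialgebraic ℚ (KZ.cube m) :=
    KZ.isSemialgebraic_cube
  have hwsa : IsSemialgebraicFunOn ℚ (KZ.cube m) W.integrand := hWd ▸ W.isSemialgebraicFunOn_integrand
  have h1sa : IsSemialgebraicFunOn ℚ (KZ.cube m) fun _ => (1 : ℝ) := by
    simpa using isSemialgebraicFunOn_ratCast hcube 1
  have hHint : IntegrableOn (fun x => W.integrand x + 1) (KZ.cube m) :=
    (hWd ▸ W.integrableOn).add (integrableOn_const (by simp [KZ.volume_cube]))
  let H : KZ.IntegralRep m := ⟨KZ.cube m, fun x => W.integrand x + 1, hcube, hwsa.fun_add h1sa, hHint⟩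
  have r₂ : KZ.of H - KZ.of W - KZ.of U₀ ∈ KZ.relations := by
    refine KZ.integrandAddRel_subset_relations ⟨m, H, W, U₀, hWd, hU₀d, fun x _ => ?_, rfl⟩
    simp [H, hU₀i]
  have hH0 : ∀ x ∈ H.domain, 0 ≤ H.integrand x := by
    intro x hx
    have hb := abs_le.mp (hWb x (by simpa [hWd] using hx))
    change 0 ≤ W.integrand x + 1
    linarith [hb.1]
  have hHle : ∀ x ∈ H.domain, H.integrand x ≤ 1 + ε := by
    intro x hx
    have hb := abs_le.mp (hWb x (by simpa [hWd] using hx))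
    change W.integrand x + 1 ≤ 1 + ε
    linarith [hb.2]
  have hHge : ∀ x ∈ H.domain, 1 - ε ≤ H.integrand x := by
    intro x hx
    have hb := abs_le.mp (hWb x (by simpa [hWd] using hx))
    change 1 - ε ≤ W.integrand x + 1
    linarith [hb.1]
  -- (4) the region under the graph `G`, one Newton–Leibniz move away
  obtain ⟨G, hGd, hGi, hGH⟩ := KZ.exists_underGraph H hH0
  have r₃ : KZ.of G - KZ.of H ∈ KZ.relations := KZ.newtonLeibnizRel_subset_relations hGH
  have hGv : G.value = 1 := by
    have h₂ := eval_eq_zero_of_mem r₂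
    have h₃ := eval_eq_zero_of_mem r₃
    simp only [map_sub, KZ.eval_of, hWv, hU₀v] at h₂ h₃
    linarith
  have hG1 : ∀ x ∈ G.domain, G.integrand x = 1 := fun x _ => by rw [hGi]
  have hGsub : G.domain ⊆ {z | (Fin.init z : Fin m → ℝ) ∈ KZ.cube m ∧ 0 ≤ z (Fin.last m) ∧ z (Fin.last m) ≤ 1 + ε} := by
    intro z hz
    rw [hGd, KZlog.mem_band] at hz
    exact ⟨hz.1, hz.2.1, hz.2.2.trans (hHle _ hz.1)⟩
  have hGb : Bornology.IsBounded G.domain := by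
    refine (Metric.isBounded_Icc (0 : Fin (m + 1) → ℝ) (fun _ => 2)).subset fun z hz => ?_
    obtain ⟨hinit, h0, h1⟩ := hGsub hz
    rw [KZ.mem_cube] at hinit
    refine ⟨fun i => ?_, fun i => ?_⟩
    · refine Fin.lastCases ?_ (fun j => ?_) i
      · exact h0
      · exact (hinit j).1
    · refine Fin.lastCases ?_ (fun j => ?_) i
      · change z (Fin.last m) ≤ 2
        linarith
      · change z (Fin.castSucc j) ≤ 2
        have := (hinit j).2
        change z (Fin.castSucc j) ≤ 1 at this
        linarith
  have hGvol : 0 < volume G.domain := by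
    have h := G.value_eq_volume_real hG1
    rw [hGv, measureReal_def] at h
    exact pos_iff_ne_zero.mpr fun h0 => by simp [h0] at h
  -- (5) the body `A = closure G`
  obtain ⟨A, hAd, hAi, hAc, hAint, r₄⟩ := KZ.exists_closure_of_integrand_one G hG1 hGb
  have hA1 : ∀ x ∈ A.domain, A.integrand x = 1 := fun x _ => by rw [hAi]
  have hAv : A.value = 1 := by
    have h := eval_eq_zero_of_mem r₄
    simp only [map_sub, KZ.eval_of, hGv] at h
    linarith
  have r₅ : KZ.of U - KZ.of U₀ ∈ KZ.relations := of_cube_sub_of_cube_mem_relations U₀ U hU₀d hU₀i hUd hUi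
  refine ⟨m, A, U, hAc, hAint hGvol, hA1, hAv, hUd, hUi, ?_, ?_, ?_⟩
  · -- lower slab ⊆ G ⊆ closure G = A
    rw [hAd]
    refine Subset.trans (fun z hz => ?_) subset_closure
    obtain ⟨hinit, h0, h1⟩ := hz
    rw [hGd, KZlog.mem_band]
    exact ⟨hinit, h0, h1.trans (hHge _ hinit)⟩
  · -- A = closure G ⊆ upper slab (closed)
    rw [hAd]
    refine closure_minimal hGsub ?_
    have hc1 : IsClosed {z : Fin (m + 1) → ℝ | (Fin.init z : Fin m → ℝ) ∈ KZ.cube m} :=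
      KZ.isClosed_cube.preimage (continuous_pi fun i => continuous_apply _)
    have hc2 : IsClosed {z : Fin (m + 1) → ℝ | 0 ≤ z (Fin.last m)} :=
      isClosed_le continuous_const (continuous_apply _)
    have hc3 : IsClosed {z : Fin (m + 1) → ℝ | z (Fin.last m) ≤ 1 + ε} :=
      isClosed_le (continuous_apply _) continuous_const
    convert (hc1.inter hc2).inter hc3 using 1
    ext z
    simp only [mem_setOf_eq, mem_inter_iff, and_assoc]
  · have : c - (KZ.of A - KZ.of U) = (c - KZ.of W) - (KZ.of H - KZ.of W - KZ.of U₀) -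
        (KZ.of G - KZ.of H) + (KZ.of G - KZ.of A) + (KZ.of U - KZ.of U₀) := by abel
    rw [this]
    exact KZ.relations.add_mem (KZ.relations.add_mem
      (KZ.relations.sub_mem (KZ.relations.sub_mem r₁ r₂) r₃) r₄) r₅

/-- **Conjecture 1 ⟺ cubing gentle bumps.** For every fixed `0 < ε < 1`: the kernel form of
Conjecture 1 holds iff every compact `ℚ`-semialgebraic body of volume `1` (integrand `1`, non-empty
interior) sandwiched between the slabs `[0,1]^m × [0, 1 − ε]` and `[0,1]^m × [0, 1 + ε]` is
KZ-equivalent to the unit cube `[0,1]^{m+1}`. (`→`: both have value `1`; `←`: the bump-body normal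
form.) [folklore] -/
theorem kernelForm_iff_bumpBody :
    ∀ {ε : ℝ}, 0 < ε → ε < 1 →
    (Summit.KontsevichZagierPeriods.KontsevichZagierPeriods.Theses.VietaFibre.KernelForm ↔
      ∀ (m : ℕ) (A U : KZ.IntegralRep (m + 1)), IsCompact A.domain → (interior A.domain).Nonempty →
        (∀ x ∈ A.domain, A.integrand x = 1) → A.value = 1 → U.domain = KZ.cube (m + 1) →
        (U.integrand = fun _ => 1) →
        {z | (Fin.init z : Fin m → ℝ) ∈ KZ.cube m ∧ 0 ≤ z (Fin.last m) ∧ z (Fin.last m) ≤ 1 - ε} ⊆ A.domain →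
        A.domain ⊆ {z | (Fin.init z : Fin m → ℝ) ∈ KZ.cube m ∧ 0 ≤ z (Fin.last m) ∧ z (Fin.last m) ≤ 1 + ε} →
        KZ.of A - KZ.of U ∈ KZ.relations) := by
  intro ε hε hε1
  constructor
  · unfold Summit.KontsevichZagierPeriods.KontsevichZagierPeriods.Theses.VietaFibre.KernelForm
    intro hK m A U _ _ _ hAv hUd hUi _ _
    refine hK _ ?_
    have hUv : U.value = 1 := by
      rw [KZ.IntegralRep.value_eq_volume_real U (fun x _ => by rw [hUi]), hUd, KZ.volume_real_cube]
    rw [map_sub, KZ.eval_of, KZ.eval_of, hAv, hUv, sub_self]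
  · unfold Summit.KontsevichZagierPeriods.KontsevichZagierPeriods.Theses.VietaFibre.KernelForm
    intro h c hc
    obtain ⟨m, A, U, hAc, hAi, hA1, hAv, hUd, hUi, hlo, hhi, e⟩ :=
      exists_bumpBody_sub_mem_relations c hc hε hε1
    have hAU := h m A U hAc hAi hA1 hAv hUd hUi hlo hhi
    have : c = (c - (KZ.of A - KZ.of U)) + (KZ.of A - KZ.of U) := by abel
    rw [this]
    exact KZ.relations.add_mem e hAU

/-- **OctahedralSymmetry twin** of `kernelForm_iff_bumpBody`. [folklore] -/
theorem octahedralSymmetry_kernelForm_iff_bumpBody :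
    ∀ {ε : ℝ}, 0 < ε → ε < 1 →
    (Summit.KontsevichZagierPeriods.KontsevichZagierPeriods.Theses.OctahedralSymmetry.KernelForm ↔
      ∀ (m : ℕ) (A U : KZ.IntegralRep (m + 1)), IsCompact A.domain → (interior A.domain).Nonempty →
        (∀ x ∈ A.domain, A.integrand x = 1) → A.value = 1 → U.domain = KZ.cube (m + 1) →
        (U.integrand = fun _ => 1) →
        {z | (Fin.init z : Fin m → ℝ) ∈ KZ.cube m ∧ 0 ≤ z (Fin.last m) ∧ z (Fin.last m) ≤ 1 - ε} ⊆ A.domain →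
        A.domain ⊆ {z | (Fin.init z : Fin m → ℝ) ∈ KZ.cube m ∧ 0 ≤ z (Fin.last m) ∧ z (Fin.last m) ≤ 1 + ε} →
        KZ.of A - KZ.of U ∈ KZ.relations) :=
  fun hε hε1 =>
    octahedralSymmetry_kernelForm_iff_vietaFibre_kernelForm.trans (kernelForm_iff_bumpBody hε hε1)

end Summit.KontsevichZagierPeriods.KernelForm.LocaliseAtValuePrime
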